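import Summits.ResolutionOfSingularities.ResolutionOfSingularities.Theorems.PurelyInseparableDim4ChartAtlasSNCGoodFarPairsCharts
import Summits.ResolutionOfSingularities.ResolutionOfSingularities.Theorems.PurelyInseparableDim4ChartAtlasSNCGoodNearPairsCharts
import Summits.ResolutionOfSingularities.ResolutionOfSingularities.Theorems.PurelyInseparableDim4ChartAtlasSNCGoodFar
import HarnessLib

/-!
# Purely inseparable four-folds `z^p + F(x₁, …, x₄)`: S3-N2 on `W` for a PAIR-LIST old boundary (parallel members allowed), EVERY `S'`, and the
# ATLAS PACKAGE keyed by pairs (cell `res-dim4-pi`, typ-2 g6)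

[OURS · counted 0] (D-0157 DOOR 2; DR-157-C; typ-2 HANDOFF OPEN items «parallel members of equal index» / «`j ∈ S'` pair-list version»; typ-3 S3c-V4
design §6 (f) «boundary list in the reading key»). The old boundary is ANY list of translated coordinate hyperplanes `E = [(xᵢ + c)·𝒪 : (i, c) ∈ L]`,
`L : List (Fin 4 × K)` (near `i ∈ S`, `c = 0`; far `i ∈ S`, `c ≠ 0`; transversal `i ∉ S`; several members per index allowed). PROVED here (no
`sorry`, no new axiom):

* `hasSNCWith_transform_boundary_globalCentre_of_far_heights_pairs` — escaping case `j ∉ S'` (p704073's proof: old boundary snc with `V(z, x_S)` by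
  p709429 `hasSNCWith_𝓘Λ_hyperplanes_pairs`, cover p688180, charts p710957 / p713030, glue p692083): under `|B_near| ≤ 1` (`(j, 0) ∈ L ⟹ b_m = 0`
  for every near `(m, 0) ∈ L`, `m ∈ S ∩ S'`; at most one near index `m ∈ S ∩ S'` with `b_m ≠ 0`) and pairwise distinct active far heights
  (`d ≠ bᵢ·c` for far `(i, d)`, `i ∈ S'`, `bᵢ ≠ 0`, and far `(j, c)`; `d·b_k ≠ d'·bᵢ` for distinct active far pairs) the escaping global centre
  `Zc` is snc with the whole transformed boundary;
* `hasSNCWith_transform_boundary_globalCentre_of_mem_pairs` — case `j ∈ S'`: `|B_near| ≤ 1` alone (the far members' strict transforms miss `Zc`,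
  p699951, and are split off by `HasSNCWith.of_disjoint`; the near/transversal sub-list is read on p699951's atlas by p713434, glued by p692083);
* `hasSNCWith_transform_boundary_globalCentre_of_nearFar_pairs` — EVERY `S'`;
* **`globalCentre_atlas_package_boundary_nearFar_pairs`** — p704887's `globalCentre_atlas_package_boundary_nearFar` VERBATIM IN SHAPE with the
  boundary keyed by pairs: re-centring `Θⱼ` of record, global centre `Zc`, chart-`j` reading, ALL THREE admissibility conjuncts (`Zc` regular,
  `V(Zc) ⊆ supp M'`, `HasSNCWith M'.boundary Zc`), the cover by the charts `x_l` (`l ∈ S ∖ (S' ∖ j)`) and the shear-chart data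
  (`T_l = {l} ∪ (S' ∖ j)` if `j ∈ S'`, else `S'`) — the by-signature entry point for atlas members with pair-list boundaries.

Nothing here is a statement about resolution of singularities in dimension ≥ 4 / characteristic `p` (NOT proved anywhere in this programme).
bears_on: LADDER-RESOLUTION:D157-DOOR2 (res-dim4-pi). Supports stmt-ResolutionOfSingularities-16155 (helper, S3-N2 positive side — entry point).
-/

-- every declaration of this summit lives under `Summit.ResolutionOfSingularities.ResolutionOfSingularities`
-- (summit = problem), which the duplicate-namespace linter flags; house convention (cf. the Target file).
set_option linter.dupNamespace false

noncomputable section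

open MvPolynomial Finset CategoryTheory AlgebraicGeometry Opposite TopologicalSpace
open AlgebraicGeometry.Scheme.IdealSheafData (ofIdealTop vanishingIdeal)

namespace Summit.ResolutionOfSingularities.ResolutionOfSingularities.Theorems.PIDim4

open Literature.AlgebraicGeometry.Resolution
open Literature.AlgebraicGeometry.Resolution.Hauser2010
open Literature.AlgebraicGeometry.Resolution.AffinePointBlowup (P A γ coord Wtop ξ)
open Literature.Barriers.ResolutionOfSingularities

namespace ChartDictionary

variable {K : Type} [Field K] {p : ℕ} [hp : Fact p.Prime] [CharP K p]
  {S S' : Finset (Fin 4)} {j : Fin 4} {b : Fin 4 → K} {Θⱼ : A 4 K ≃ₐ[K] A 4 K} {h : MvPolynomial (Fin 4) K}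
  {F F₁ : MvPolynomial (Fin 4) K} {W : Scheme.{0}} {π : W ⟶ P 4 K}

/-- **THE FAR POSITIVE OF S3-N2 ON `W` FOR A PAIR-LIST BOUNDARY (escaping case `j ∉ S'`).** Old boundary `E = [(xᵢ + c)·𝒪 : (i, c) ∈ L]`; `π` ANY blowing up
of `𝔸⁵` along `V(z, x_S)`; `Θⱼ` the re-centring of record at `b` (`b_j = 0`) with reading `z^p + F ↦ x_j^p (z^p + F₁)`, `F ≠ 0` clean `S`-permissible,
`F₁` `S'`-permissible. -/
theorem hasSNCWith_transform_boundary_globalCentre_of_far_heights_pairs [IsAlgClosed K] (hj : j ∈ S) (hjS' : j ∉ S') (hbj : b j = 0)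
    (hF : F ≠ 0) (hclean : HauserPerlega.IsClean p F) (h0j : Θⱼ (X 0) = X 0 + rename Fin.succ h)
    (hsj : ∀ i : Fin 4, Θⱼ (X i.succ) = X i.succ + C (b i))
    (hπ : IsBlowup π (AffineCoordBlowup.𝓘Λ 4 K (insert 0 (Fin.succ '' (S : Set (Fin 4))))))
    (hperm : (p : ℕ∞) ≤ CentreBlowup.ordAlong S F)
    (hread : Θⱼ (coordBlowupSubst K (insert 0 (Fin.succ '' (S : Set (Fin 4)))) j.succ (hyp p F)) = X j.succ ^ p * hyp p F₁)
    (hperm' : (p : ℕ∞) ≤ CentreBlowup.ordAlong S' F₁) (L : List (Fin 4 × K))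
    (hB1 : (j, (0 : K)) ∈ L → ∀ mc ∈ L, mc.1 ∈ S → mc.1 ∈ S' → mc.2 = 0 → b mc.1 = 0)
    (hB2 : ∀ mc ∈ L, ∀ mc' ∈ L, mc.1 ∈ S → mc'.1 ∈ S → mc.1 ∈ S' → mc'.1 ∈ S' → mc.2 = 0 → mc'.2 = 0 → b mc.1 ≠ 0 → b mc'.1 ≠ 0 →
      mc.1 = mc'.1)
    (hH1 : ∀ ic ∈ L, ic.1 ∈ S → ic.2 ≠ 0 → ic.1 ∈ S' → b ic.1 ≠ 0 → ∀ c : K, (j, c) ∈ L → c ≠ 0 → ic.2 ≠ b ic.1 * c)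
    (hH2 : ∀ ic ∈ L, ∀ kd ∈ L, ic ≠ kd → ic.1 ∈ S → kd.1 ∈ S → ic.2 ≠ 0 → kd.2 ≠ 0 → ic.1 ∈ S' → kd.1 ∈ S' → b ic.1 ≠ 0 → b kd.1 ≠ 0 →
      ic.2 * b kd.1 ≠ kd.2 * b ic.1) :
    haveI : IsIso (CommRingCat.ofHom (Θⱼ : A 4 K →+* A 4 K)) := (inferInstance : IsIso Θⱼ.toRingEquiv.toCommRingCatIso.hom)
    HasSNCWith
      ((⟨hypSheaf p F, L.map fun ic => ofIdealTop (Ideal.span {(γ 4 K).symm (X ic.1.succ + C ic.2)}), p⟩ :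
          MarkedIdeal (P 4 K)).transform π (AffineCoordBlowup.𝓘Λ 4 K (insert 0 (Fin.succ '' (S : Set (Fin 4)))))).boundary
      (vanishingIdeal (closureImage
        (Spec.map (CommRingCat.ofHom (Θⱼ : A 4 K →+* A 4 K)) ≫ AffineCoordBlowup.chartImm hπ (succ_mem_centreVars hj))
        ((AffineCoordBlowup.𝓘Λ 4 K (insert 0 (Fin.succ '' (S' : Set (Fin 4))))).support : Set (P 4 K)))) := by
  classical
  haveI hisoj : IsIso (CommRingCat.ofHom (Θⱼ : A 4 K →+* A 4 K)) :=
    (inferInstance : IsIso Θⱼ.toRingEquiv.toCommRingCatIso.hom)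
  haveI : IsProper π := hπ.isProper
  haveI : IsLocallyNoetherian W := LocallyOfFiniteType.isLocallyNoetherian π
  set Λ : Set (Fin (4 + 1)) := insert 0 (Fin.succ '' (S : Set (Fin 4))) with hΛ
  set φⱼ := Spec.map (CommRingCat.ofHom (Θⱼ : A 4 K →+* A 4 K)) ≫ AffineCoordBlowup.chartImm hπ (succ_mem_centreVars hj)
    with hφⱼ
  set Zc := vanishingIdeal (closureImage φⱼ
    ((AffineCoordBlowup.𝓘Λ 4 K (insert 0 (Fin.succ '' (S' : Set (Fin 4))))).support : Set (P 4 K))) with hZc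
  set E : List (Scheme.IdealSheafData (P 4 K)) := L.map fun ic => ofIdealTop (Ideal.span {(γ 4 K).symm (X ic.1.succ + C ic.2)})
    with hEdef
  -- (i) the old boundary is snc with the centre `V(z, x_S)`
  have hE : HasSNCWith E (AffineCoordBlowup.𝓘Λ 4 K Λ) := by
    refine hasSNCWith_𝓘Λ_hyperplanes_pairs Λ (L.toFinset.image fun ic => (ic.1.succ, ic.2)) fun D hD => Or.inr ?_
    obtain ⟨ic, hic, rfl⟩ := List.mem_map.mp hD
    exact ⟨(ic.1.succ, ic.2), Finset.mem_image.mpr ⟨ic, List.mem_toFinset.mpr hic, rfl⟩, rfl⟩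
  have hsncW : HasSNC (((⟨hypSheaf p F, E, p⟩ : MarkedIdeal (P 4 K)).transform π (AffineCoordBlowup.𝓘Λ 4 K Λ)).boundary) := by
    rw [MarkedIdeal.transform_boundary]
    exact hE.hasSNC_transform hπ
  -- (ii) cover, (iii) shear charts of the atlas
  have hcov := support_globalCentre_subset_iUnion hj hjS' hbj h0j hsj hπ hperm hread hperm'
  have hchart : ∀ l : {l : Fin 4 // l ∈ S \ S'}, l.1 ≠ j →
      ∃ (Θ : A 4 K ≃ₐ[K] A 4 K) (τ : MvPolynomial (Fin 4) K ≃ₐ[K] MvPolynomial (Fin 4) K)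
        (_ : IsIso (CommRingCat.ofHom (Θ : A 4 K →+* A 4 K))),
        (∀ i : Fin 4, Θ (X i.succ) = rename Fin.succ (τ (X i))) ∧ τ (X j) = X j ∧ τ (X l.1) = X l.1 ∧
        (∀ i ∈ S, i ≠ j → i ≠ l.1 → τ (X i) = X i + C (b i) * X j) ∧ (∀ k ∉ S, τ (X k) = X k + C (b k)) ∧
        Zc.comap (Spec.map (CommRingCat.ofHom (Θ : A 4 K →+* A 4 K)) ≫
            AffineCoordBlowup.chartImm hπ (succ_mem_centreVars (Finset.mem_sdiff.mp l.2).1)) =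
          AffineCoordBlowup.𝓘Λ 4 K (insert 0 (Fin.succ '' (S' : Set (Fin 4)))) := by
    intro l hlj
    obtain ⟨hlS, hlS'⟩ := Finset.mem_sdiff.mp l.2
    obtain ⟨Θ, τ, g, hiso, -, hτ, hτj, hτl, hτS, hτk, -, hZ, -, -, -, -⟩ :=
      exists_shear_chart_reading hj hjS' hbj hF hclean h0j hsj hπ hperm hread hperm' hlS hlS' (Ne.symm hlj)
    exact ⟨Θ, τ, hiso, hτ, hτj, hτl, hτS, hτk, hZ⟩
  choose Θf τf hisof hτf hτjf hτlf hτSf hτkf hZf using hchart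
  let U : {l : Fin 4 // l ∈ S \ S'} → Scheme.{0} := fun _ => P 4 K
  let φ : ∀ l : {l : Fin 4 // l ∈ S \ S'}, U l ⟶ W := fun l =>
    if hlj : l.1 = j then φⱼ
    else Spec.map (CommRingCat.ofHom (Θf l hlj : A 4 K →+* A 4 K)) ≫
      AffineCoordBlowup.chartImm hπ (succ_mem_centreVars (Finset.mem_sdiff.mp l.2).1)
  haveI hφ : ∀ l, IsOpenImmersion (φ l) := fun l => by
    by_cases hlj : l.1 = j
    · simp only [φ, dif_pos hlj, hφⱼ]
      infer_instance
    · simp only [φ, dif_neg hlj]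
      haveI := hisof l hlj
      infer_instance
  refine hasSNCWith_of_cover_comap φ hsncW ?_ fun l => ?_
  · intro w hw
    obtain ⟨l, hl⟩ := Set.mem_iUnion.mp (hcov hw)
    obtain ⟨hl, hw'⟩ := Set.mem_iUnion.mp hl
    refine Set.mem_iUnion.mpr ⟨⟨l, hl⟩, ?_⟩
    by_cases hlj : l = j
    · subst hlj
      simp only [φ, dif_pos rfl, hφⱼ]
      rw [range_specMap_comp_chartImm]
      exact hw'
    · simp only [φ, dif_neg hlj]
      rw [range_specMap_comp_chartImm]
      exact hw'
  · by_cases hlj : l.1 = j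
    · simp only [φ, dif_pos hlj]
      rw [hφⱼ, comap_globalCentre, MarkedIdeal.transform_boundary]
      exact hasSNCWith_boundary_readings_translate_chart_pairs hj hjS' hbj L hsj hH1 hH2 hπ
    · simp only [φ, dif_neg hlj]
      rw [hZf l hlj, MarkedIdeal.transform_boundary]
      obtain ⟨hlS, -⟩ := Finset.mem_sdiff.mp l.2
      haveI := hisof l hlj
      exact hasSNCWith_boundary_readings_shear_chart_pairs hlS hj hjS' (Ne.symm hlj) L (hτf l hlj) (hτjf l hlj) (hτlf l hlj)
        (hτSf l hlj) (hτkf l hlj) hB1 hB2 hH1 hH2 hπ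


/-- **S3-N2 ON `W` FOR A PAIR-LIST BOUNDARY, CASE `j ∈ S'`.** Old boundary `E = [(xᵢ + c)·𝒪 : (i, c) ∈ L]`; `π` ANY blowing up of `𝔸⁵` along
`V(z, x_S)`; `Θⱼ` the re-centring of record at `b` (`b_j = 0`) with reading `z^p + F ↦ x_j^p (z^p + F₁)`, `F₁` `S'`-permissible, `j ∈ S'`. Under
`|B_near| ≤ 1` (`(j, 0) ∈ L ⟹ b_m = 0` for every near `(m, 0) ∈ L`, `m ∈ S ∩ S'`; at most one near index `m ∈ S ∩ S'` with `b_m ≠ 0`) the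
escaping global centre `Zc` is snc with the whole transformed boundary — no condition on the far members, which never meet `Zc`. -/
theorem hasSNCWith_transform_boundary_globalCentre_of_mem_pairs [IsAlgClosed K] (hj : j ∈ S) (hjS' : j ∈ S') (hbj : b j = 0)
    (hF : F ≠ 0) (hclean : HauserPerlega.IsClean p F) (h0j : Θⱼ (X 0) = X 0 + rename Fin.succ h)
    (hsj : ∀ i : Fin 4, Θⱼ (X i.succ) = X i.succ + C (b i))
    (hπ : IsBlowup π (AffineCoordBlowup.𝓘Λ 4 K (insert 0 (Fin.succ '' (S : Set (Fin 4))))))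
    (hperm : (p : ℕ∞) ≤ CentreBlowup.ordAlong S F)
    (hread : Θⱼ (coordBlowupSubst K (insert 0 (Fin.succ '' (S : Set (Fin 4)))) j.succ (hyp p F)) = X j.succ ^ p * hyp p F₁)
    (hperm' : (p : ℕ∞) ≤ CentreBlowup.ordAlong S' F₁) (L : List (Fin 4 × K))
    (hB1 : (j, (0 : K)) ∈ L → ∀ mc ∈ L, mc.1 ∈ S → mc.1 ∈ S' → mc.2 = 0 → b mc.1 = 0)
    (hB2 : ∀ mc ∈ L, ∀ mc' ∈ L, mc.1 ∈ S → mc'.1 ∈ S → mc.1 ∈ S' → mc'.1 ∈ S' → mc.2 = 0 → mc'.2 = 0 → b mc.1 ≠ 0 → b mc'.1 ≠ 0 →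
      mc.1 = mc'.1) :
    haveI : IsIso (CommRingCat.ofHom (Θⱼ : A 4 K →+* A 4 K)) := (inferInstance : IsIso Θⱼ.toRingEquiv.toCommRingCatIso.hom)
    HasSNCWith
      ((⟨hypSheaf p F, L.map fun ic => ofIdealTop (Ideal.span {(γ 4 K).symm (X ic.1.succ + C ic.2)}), p⟩ :
          MarkedIdeal (P 4 K)).transform π (AffineCoordBlowup.𝓘Λ 4 K (insert 0 (Fin.succ '' (S : Set (Fin 4)))))).boundary
      (vanishingIdeal (closureImage
        (Spec.map (CommRingCat.ofHom (Θⱼ : A 4 K →+* A 4 K)) ≫ AffineCoordBlowup.chartImm hπ (succ_mem_centreVars hj))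
        ((AffineCoordBlowup.𝓘Λ 4 K (insert 0 (Fin.succ '' (S' : Set (Fin 4))))).support : Set (P 4 K)))) := by
  classical
  haveI hisoj : IsIso (CommRingCat.ofHom (Θⱼ : A 4 K →+* A 4 K)) :=
    (inferInstance : IsIso Θⱼ.toRingEquiv.toCommRingCatIso.hom)
  haveI : IsProper π := hπ.isProper
  haveI : IsLocallyNoetherian W := LocallyOfFiniteType.isLocallyNoetherian π
  set Λ : Set (Fin (4 + 1)) := insert 0 (Fin.succ '' (S : Set (Fin 4))) with hΛ
  set φⱼ := Spec.map (CommRingCat.ofHom (Θⱼ : A 4 K →+* A 4 K)) ≫ AffineCoordBlowup.chartImm hπ (succ_mem_centreVars hj)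
    with hφⱼ
  set Zc := vanishingIdeal (closureImage φⱼ
    ((AffineCoordBlowup.𝓘Λ 4 K (insert 0 (Fin.succ '' (S' : Set (Fin 4))))).support : Set (P 4 K))) with hZc
  -- the hyperplane of a pair, and the sub-list WITHOUT far members
  let hypOf : Fin 4 × K → Scheme.IdealSheafData (P 4 K) := fun ic => ofIdealTop (Ideal.span {(γ 4 K).symm (X ic.1.succ + C ic.2)})
  let L₁ : List (Fin 4 × K) := L.filter fun ic => ic.1 ∉ S ∨ ic.2 = 0
  have hL₁ : ∀ ic, ic ∈ L₁ ↔ ic ∈ L ∧ (ic.1 ∉ S ∨ ic.2 = 0) := fun ic => by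
    simp only [L₁, List.mem_filter, decide_eq_true_eq]
  have hL₁far : ∀ ic ∈ L₁, ic.1 ∈ S → ic.2 = 0 := fun ic hic hiS => ((hL₁ ic).mp hic).2.resolve_left fun h' => h' hiS
  have hL₁L : ∀ ic ∈ L₁, ic ∈ L := fun ic hic => ((hL₁ ic).mp hic).1
  -- any pair list is snc with `V(z, x_S)`, hence its transformed boundary is snc on `W`
  have hsnc : ∀ L' : List (Fin 4 × K), HasSNCWith (L'.map hypOf) (AffineCoordBlowup.𝓘Λ 4 K Λ) := fun L' => by
    refine hasSNCWith_𝓘Λ_hyperplanes_pairs Λ (L'.toFinset.image fun ic => (ic.1.succ, ic.2)) fun D hD => Or.inr ?_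
    obtain ⟨ic, hic, rfl⟩ := List.mem_map.mp hD
    exact ⟨(ic.1.succ, ic.2), Finset.mem_image.mpr ⟨ic, List.mem_toFinset.mpr hic, rfl⟩, rfl⟩
  -- (i) the near/transversal sub-list: cover (p699951), charts (p713434), glue (p692083)
  have hnear : HasSNCWith (((⟨hypSheaf p F, L₁.map hypOf, p⟩ : MarkedIdeal (P 4 K)).transform π
      (AffineCoordBlowup.𝓘Λ 4 K Λ)).boundary) Zc := by
    have hsncW₁ : HasSNC (((⟨hypSheaf p F, L₁.map hypOf, p⟩ : MarkedIdeal (P 4 K)).transform π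
        (AffineCoordBlowup.𝓘Λ 4 K Λ)).boundary) := by
      rw [MarkedIdeal.transform_boundary]
      exact (hsnc L₁).hasSNC_transform hπ
    have hcov := support_globalCentre_subset_iUnion_of_mem hj hjS' hbj h0j hsj hπ hperm hread hperm'
    have hchart : ∀ l : {l : Fin 4 // l ∈ S \ S'.erase j}, l.1 ≠ j →
        ∃ (Θ : A 4 K ≃ₐ[K] A 4 K) (τ : MvPolynomial (Fin 4) K ≃ₐ[K] MvPolynomial (Fin 4) K)
          (_ : IsIso (CommRingCat.ofHom (Θ : A 4 K →+* A 4 K))),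
          (∀ i : Fin 4, Θ (X i.succ) = rename Fin.succ (τ (X i))) ∧ τ (X j) = X j ∧ τ (X l.1) = X l.1 ∧
          (∀ i ∈ S, i ≠ j → i ≠ l.1 → τ (X i) = X i + C (b i) * X j) ∧ (∀ k ∉ S, τ (X k) = X k + C (b k)) ∧
          Zc.comap (Spec.map (CommRingCat.ofHom (Θ : A 4 K →+* A 4 K)) ≫
              AffineCoordBlowup.chartImm hπ (succ_mem_centreVars (Finset.mem_sdiff.mp l.2).1)) =
            AffineCoordBlowup.𝓘Λ 4 K (insert 0 (Fin.succ '' ((insert l.1 (S'.erase j) : Finset (Fin 4)) : Set (Fin 4)))) := by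
      intro l hlj
      obtain ⟨hlS, hlS''⟩ := Finset.mem_sdiff.mp l.2
      have hlS' : l.1 ∉ S' := fun h' => hlS'' (Finset.mem_erase.mpr ⟨hlj, h'⟩)
      obtain ⟨Θ, τ, g, hiso, -, hτ, hτj, hτl, hτS, hτk, -, hZ, -, -, -, -⟩ :=
        exists_shear_chart_reading_of_mem hj hjS' hbj hF hclean h0j hsj hπ hperm hread hperm' hlS hlS'
      exact ⟨Θ, τ, hiso, hτ, hτj, hτl, hτS, hτk, hZ⟩
    choose Θf τf hisof hτf hτjf hτlf hτSf hτkf hZf using hchart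
    let U : {l : Fin 4 // l ∈ S \ S'.erase j} → Scheme.{0} := fun _ => P 4 K
    let φ : ∀ l : {l : Fin 4 // l ∈ S \ S'.erase j}, U l ⟶ W := fun l =>
      if hlj : l.1 = j then φⱼ
      else Spec.map (CommRingCat.ofHom (Θf l hlj : A 4 K →+* A 4 K)) ≫
        AffineCoordBlowup.chartImm hπ (succ_mem_centreVars (Finset.mem_sdiff.mp l.2).1)
    haveI hφ : ∀ l, IsOpenImmersion (φ l) := fun l => by
      by_cases hlj : l.1 = j
      · simp only [φ, dif_pos hlj, hφⱼ]
        infer_instance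
      · simp only [φ, dif_neg hlj]
        haveI := hisof l hlj
        infer_instance
    refine hasSNCWith_of_cover_comap φ hsncW₁ ?_ fun l => ?_
    · intro w hw
      obtain ⟨l, hl⟩ := Set.mem_iUnion.mp (hcov hw)
      obtain ⟨hl, hw'⟩ := Set.mem_iUnion.mp hl
      refine Set.mem_iUnion.mpr ⟨⟨l, hl⟩, ?_⟩
      by_cases hlj : l = j
      · subst hlj
        simp only [φ, dif_pos rfl, hφⱼ]
        rw [range_specMap_comp_chartImm]
        exact hw'
      · simp only [φ, dif_neg hlj]
        rw [range_specMap_comp_chartImm]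
        exact hw'
    · by_cases hlj : l.1 = j
      · simp only [φ, dif_pos hlj]
        rw [hφⱼ, comap_globalCentre, MarkedIdeal.transform_boundary]
        exact hasSNCWith_boundary_readings_translate_chart_near_pairs hj hbj L₁ hL₁far hsj hπ _
      · simp only [φ, dif_neg hlj]
        rw [hZf l hlj, MarkedIdeal.transform_boundary]
        obtain ⟨hlS, -⟩ := Finset.mem_sdiff.mp l.2
        haveI := hisof l hlj
        have hmemT : ∀ {m : Fin 4}, m ≠ l.1 → m ∈ insert l.1 (S'.erase j) → m ∈ S' := fun hml hmT => by
          rcases Finset.mem_insert.mp hmT with e | e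
          · exact absurd e hml
          · exact (Finset.mem_erase.mp e).2
        have hjT : j ∉ insert l.1 (S'.erase j) := fun h' => by
          rcases Finset.mem_insert.mp h' with e | e
          · exact hlj e.symm
          · exact Finset.notMem_erase j S' e
        refine hasSNCWith_boundary_readings_shear_chart_near_pairs hlS hj (Ne.symm hlj) hjT L₁ hL₁far (hτf l hlj) (hτjf l hlj)
          (hτlf l hlj) (hτSf l hlj) (hτkf l hlj) ?_ ?_ hπ
        · intro hj0 mc hmc hmS _ hml hmT hc0
          exact hB1 (hL₁L _ hj0) mc (hL₁L _ hmc) hmS (hmemT hml hmT) hc0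
        · intro mc hmc mc' hmc' hmS hm'S hml hm'l hmT hm'T hc0 hc0' hbm hbm'
          exact hB2 mc (hL₁L _ hmc) mc' (hL₁L _ hmc') hmS hm'S (hmemT hml hmT) (hmemT hm'l hm'T) hc0 hc0' hbm hbm'
  -- (ii) all members: the far ones miss `Zc` (p699951), the rest is (i)
  rw [MarkedIdeal.transform_boundary] at hnear ⊢
  refine HasSNCWith.of_disjoint hnear ((hsnc L).hasSNC_transform hπ) fun D hD hDn => ?_
  rcases List.mem_append.mp hD with hD | hD
  · obtain ⟨D₀, hD₀, rfl⟩ := List.mem_map.mp hD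
    obtain ⟨ic, hic, rfl⟩ := List.mem_map.mp hD₀
    have hfar : ic.1 ∈ S ∧ ic.2 ≠ 0 := by
      by_contra hn
      refine hDn (List.mem_append.mpr (Or.inl (List.mem_map.mpr ⟨hypOf ic, List.mem_map.mpr ⟨ic, (hL₁ ic).mpr ⟨hic, ?_⟩, rfl⟩, rfl⟩)))
      by_cases h1 : ic.1 ∈ S
      · right
        by_contra h2
        exact hn ⟨h1, h2⟩
      · exact Or.inl h1
    exact support_strictTransform_far_inter_support_globalCentre hj hjS' hbj hsj hπ hfar.1 hfar.2
  · exact absurd (List.mem_append.mpr (Or.inr hD)) hDn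

/-- **S3-N2 ON `W` FOR A PAIR-LIST BOUNDARY, EVERY `S'`.** Under `|B_near| ≤ 1` and, WHEN `j ∉ S'`, pairwise distinct active far heights
(`d ≠ bᵢ·c` for far `(i, d)`, `i ∈ S'`, `bᵢ ≠ 0`, and far `(j, c)`; `d·b_k ≠ d'·bᵢ` for distinct active far pairs), the escaping global
centre `Zc` is snc with the whole transformed boundary (`j ∈ S'`: `…_of_mem_pairs`; `j ∉ S'`: `…_of_far_heights_pairs`). -/
theorem hasSNCWith_transform_boundary_globalCentre_of_nearFar_pairs [IsAlgClosed K] (hj : j ∈ S) (hbj : b j = 0)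
    (hF : F ≠ 0) (hclean : HauserPerlega.IsClean p F) (h0j : Θⱼ (X 0) = X 0 + rename Fin.succ h)
    (hsj : ∀ i : Fin 4, Θⱼ (X i.succ) = X i.succ + C (b i))
    (hπ : IsBlowup π (AffineCoordBlowup.𝓘Λ 4 K (insert 0 (Fin.succ '' (S : Set (Fin 4))))))
    (hperm : (p : ℕ∞) ≤ CentreBlowup.ordAlong S F)
    (hread : Θⱼ (coordBlowupSubst K (insert 0 (Fin.succ '' (S : Set (Fin 4)))) j.succ (hyp p F)) = X j.succ ^ p * hyp p F₁)
    (hperm' : (p : ℕ∞) ≤ CentreBlowup.ordAlong S' F₁) (L : List (Fin 4 × K))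
    (hB1 : (j, (0 : K)) ∈ L → ∀ mc ∈ L, mc.1 ∈ S → mc.1 ∈ S' → mc.2 = 0 → b mc.1 = 0)
    (hB2 : ∀ mc ∈ L, ∀ mc' ∈ L, mc.1 ∈ S → mc'.1 ∈ S → mc.1 ∈ S' → mc'.1 ∈ S' → mc.2 = 0 → mc'.2 = 0 → b mc.1 ≠ 0 → b mc'.1 ≠ 0 →
      mc.1 = mc'.1)
    (hH1 : j ∉ S' → ∀ ic ∈ L, ic.1 ∈ S → ic.2 ≠ 0 → ic.1 ∈ S' → b ic.1 ≠ 0 → ∀ c : K, (j, c) ∈ L → c ≠ 0 → ic.2 ≠ b ic.1 * c)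
    (hH2 : j ∉ S' → ∀ ic ∈ L, ∀ kd ∈ L, ic ≠ kd → ic.1 ∈ S → kd.1 ∈ S → ic.2 ≠ 0 → kd.2 ≠ 0 → ic.1 ∈ S' → kd.1 ∈ S' → b ic.1 ≠ 0 →
      b kd.1 ≠ 0 → ic.2 * b kd.1 ≠ kd.2 * b ic.1) :
    haveI : IsIso (CommRingCat.ofHom (Θⱼ : A 4 K →+* A 4 K)) := (inferInstance : IsIso Θⱼ.toRingEquiv.toCommRingCatIso.hom)
    HasSNCWith
      ((⟨hypSheaf p F, L.map fun ic => ofIdealTop (Ideal.span {(γ 4 K).symm (X ic.1.succ + C ic.2)}), p⟩ :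
          MarkedIdeal (P 4 K)).transform π (AffineCoordBlowup.𝓘Λ 4 K (insert 0 (Fin.succ '' (S : Set (Fin 4)))))).boundary
      (vanishingIdeal (closureImage
        (Spec.map (CommRingCat.ofHom (Θⱼ : A 4 K →+* A 4 K)) ≫ AffineCoordBlowup.chartImm hπ (succ_mem_centreVars hj))
        ((AffineCoordBlowup.𝓘Λ 4 K (insert 0 (Fin.succ '' (S' : Set (Fin 4))))).support : Set (P 4 K)))) := by
  by_cases hjS' : j ∈ S'
  · exact hasSNCWith_transform_boundary_globalCentre_of_mem_pairs hj hjS' hbj hF hclean h0j hsj hπ hperm hread hperm' L hB1 hB2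
  · exact hasSNCWith_transform_boundary_globalCentre_of_far_heights_pairs hj hjS' hbj hF hclean h0j hsj hπ hperm hread hperm' L hB1
      hB2 (hH1 hjS') (hH2 hjS')

/-- **THE S3-N1 ATLAS PACKAGE WITH A PAIR-LIST OLD BOUNDARY (every `S'`).** p704887's `globalCentre_atlas_package_boundary_nearFar` for the
marked ideal `((z^p + s.F)·𝒪, E, p)`, `E = [(xᵢ + c)·𝒪 : (i, c) ∈ L]` any pair list, under `|B_near| ≤ 1` and (when `j ∉ S'`) pairwise
distinct active far heights: the re-centring `Θⱼ`, global centre `Zc`, cover and chart readings (`T_l = {l} ∪ (S' ∖ j)` if `j ∈ S'`, else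
`S'`), and ALL THREE admissibility conjuncts (`Zc` regular, `V(Zc) ⊆ supp M'`, `HasSNCWith M'.boundary Zc`) for the transform WITH this
boundary. Resolution of singularities in dimension ≥ 4 / characteristic `p` is NOT proved. -/
theorem globalCentre_atlas_package_boundary_nearFar_pairs [IsAlgClosed K] [DecidableEq K] (hj : j ∈ S) (hbj : b j = 0) (s : State K)
    (hF : s.F ≠ 0) (hclean : HauserPerlega.IsClean p s.F) (hperm : (p : ℕ∞) ≤ CentreBlowup.ordAlong S s.F)
    (hπ : IsBlowup π (AffineCoordBlowup.𝓘Λ 4 K (insert 0 (Fin.succ '' (S : Set (Fin 4))))))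
    (hperm' : (p : ℕ∞) ≤ CentreBlowup.ordAlong S' (CentreBlowup.step p S j b s).F) (L : List (Fin 4 × K))
    (hB1 : (j, (0 : K)) ∈ L → ∀ mc ∈ L, mc.1 ∈ S → mc.1 ∈ S' → mc.2 = 0 → b mc.1 = 0)
    (hB2 : ∀ mc ∈ L, ∀ mc' ∈ L, mc.1 ∈ S → mc'.1 ∈ S → mc.1 ∈ S' → mc'.1 ∈ S' → mc.2 = 0 → mc'.2 = 0 → b mc.1 ≠ 0 → b mc'.1 ≠ 0 →
      mc.1 = mc'.1)
    (hH1 : j ∉ S' → ∀ ic ∈ L, ic.1 ∈ S → ic.2 ≠ 0 → ic.1 ∈ S' → b ic.1 ≠ 0 → ∀ c : K, (j, c) ∈ L → c ≠ 0 → ic.2 ≠ b ic.1 * c)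
    (hH2 : j ∉ S' → ∀ ic ∈ L, ∀ kd ∈ L, ic ≠ kd → ic.1 ∈ S → kd.1 ∈ S → ic.2 ≠ 0 → kd.2 ≠ 0 → ic.1 ∈ S' → kd.1 ∈ S' → b ic.1 ≠ 0 →
      b kd.1 ≠ 0 → ic.2 * b kd.1 ≠ kd.2 * b ic.1) :
    ∃ (Θⱼ : A 4 K ≃ₐ[K] A 4 K) (h : MvPolynomial (Fin 4) K) (_ : IsIso (CommRingCat.ofHom (Θⱼ : A 4 K →+* A 4 K))),
      Θⱼ (X 0) = X 0 + rename Fin.succ h ∧ (∀ i : Fin 4, Θⱼ (X i.succ) = X i.succ + C (b i)) ∧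
      let φⱼ := Spec.map (CommRingCat.ofHom (Θⱼ : A 4 K →+* A 4 K)) ≫ AffineCoordBlowup.chartImm hπ (succ_mem_centreVars hj)
      let Zc := vanishingIdeal (closureImage φⱼ ((AffineCoordBlowup.𝓘Λ 4 K
        (insert 0 (Fin.succ '' (S' : Set (Fin 4))))).support : Set (P 4 K)))
      let M' := ((⟨hypSheaf p s.F, L.map fun ic => ofIdealTop (Ideal.span {(γ 4 K).symm (X ic.1.succ + C ic.2)}), p⟩ :
        MarkedIdeal (P 4 K)).transform π (AffineCoordBlowup.𝓘Λ 4 K (insert 0 (Fin.succ '' (S : Set (Fin 4))))))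
      (M'.ideal.comap φⱼ = hypSheaf p (CentreBlowup.step p S j b s).F ∧
        Zc.comap φⱼ = AffineCoordBlowup.𝓘Λ 4 K (insert 0 (Fin.succ '' (S' : Set (Fin 4)))) ∧
        Scheme.IsRegular Zc.subscheme ∧ (Zc.support : Set W) ⊆ M'.support ∧ HasSNCWith M'.boundary Zc) ∧
      ((Zc.support : Set W) ⊆ ⋃ (l : Fin 4) (hl : l ∈ S \ S'.erase j),
        ((AffineCoordBlowup.chartImm hπ (succ_mem_centreVars (Finset.mem_sdiff.mp hl).1)).opensRange : Set W)) ∧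
      ∀ (l : Fin 4) (hl : l ∈ S), l ∉ S' → j ≠ l →
        ∃ (Θ : A 4 K ≃ₐ[K] A 4 K) (τ : MvPolynomial (Fin 4) K ≃ₐ[K] MvPolynomial (Fin 4) K) (g : MvPolynomial (Fin 4) K)
          (_ : IsIso (CommRingCat.ofHom (Θ : A 4 K →+* A 4 K))),
          Θ (X 0) = X 0 + rename Fin.succ g ∧ (∀ i : Fin 4, Θ (X i.succ) = rename Fin.succ (τ (X i))) ∧
          τ (X j) = X j ∧ τ (X l) = X l ∧ (∀ i ∈ S, i ≠ j → i ≠ l → τ (X i) = X i + C (b i) * X j) ∧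
          (∀ k ∉ S, τ (X k) = X k + C (b k)) ∧
          let φ := Spec.map (CommRingCat.ofHom (Θ : A 4 K →+* A 4 K)) ≫
            AffineCoordBlowup.chartImm hπ (succ_mem_centreVars hl)
          let Fl := g ^ p + τ (CentreBlowup.chartTransform p S l s.F)
          let Tl : Finset (Fin 4) := if j ∈ S' then insert l (S'.erase j) else S'
          M'.ideal.comap φ = hypSheaf p Fl ∧
          Zc.comap φ = AffineCoordBlowup.𝓘Λ 4 K (insert 0 (Fin.succ '' (Tl : Set (Fin 4)))) ∧
          Fl ≠ 0 ∧ HauserPerlega.IsClean p Fl ∧ (p : ℕ∞) ≤ CentreBlowup.ordAlong Tl Fl ∧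
          ((AffineCoordBlowup.𝓘Λ 4 K (insert 0 (Fin.succ '' (S : Set (Fin 4))))).comap π).comap φ =
            ofIdealTop (Ideal.span {(γ 4 K).symm (X l.succ + C 0)}) := by
  haveI : PerfectRing K p := PerfectRing.ofSurjective K p fun x => IsAlgClosed.exists_pow_nat_eq x hp.out.pos
  obtain ⟨θ, h, h0, hs, h1, -⟩ := exists_clean_translate_hyp_eq_step p hj hbj s hperm
  -- the re-centring of record of the `x_j`-chart: translation by `b`, then cleaning by `h` (as in p697935 / p704887)
  let Θⱼ : A 4 K ≃ₐ[K] A 4 K := (AffinePointBlowup.translateEquiv (Fin.cases 0 b)).trans θ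
  have hΘ0 : Θⱼ (X 0) = X 0 + rename Fin.succ h := by
    change θ (AffinePointBlowup.translateEquiv (Fin.cases 0 b) (X 0)) = _
    rw [AffinePointBlowup.translateEquiv_X, Fin.cases_zero, C_0, add_zero, h0]
  have hΘs : ∀ i : Fin 4, Θⱼ (X i.succ) = X i.succ + C (b i) := fun i => by
    change θ (AffinePointBlowup.translateEquiv (Fin.cases 0 b) (X i.succ)) = _
    rw [AffinePointBlowup.translateEquiv_X, Fin.cases_succ, map_add, hs]
    exact congrArg _ (θ.commutes (b i))
  have hread : Θⱼ (coordBlowupSubst K (insert 0 (Fin.succ '' (S : Set (Fin 4)))) j.succ (hyp p s.F)) =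
      X j.succ ^ p * hyp p (CentreBlowup.step p S j b s).F := by
    change θ (AffinePointBlowup.translateEquiv (Fin.cases 0 b) _) = _
    rw [← h1]
    rfl
  haveI hiso : IsIso (CommRingCat.ofHom (Θⱼ : A 4 K →+* A 4 K)) :=
    (inferInstance : IsIso Θⱼ.toRingEquiv.toCommRingCatIso.hom)
  refine ⟨Θⱼ, h, hiso, hΘ0, hΘs, ⟨?_, ?_, ?_, ?_, ?_⟩, ?_, fun l hl hlS' hjl => ?_⟩
  · exact comap_chart_transform_ideal_of_reading hj hbj hΘ0 hΘs hπ hperm hread _ rfl rfl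
  · exact comap_globalCentre _ _
  · exact isRegular_globalCentre_of_reading hj hbj hΘ0 hΘs hπ hperm hread hperm'
  · exact support_globalCentre_subset_support_transform_of_reading hj hbj hΘ0 hΘs hπ hperm hread hperm' _ rfl rfl
  · exact hasSNCWith_transform_boundary_globalCentre_of_nearFar_pairs hj hbj hF hclean hΘ0 hΘs hπ hperm hread hperm' L hB1 hB2 hH1 hH2
  · by_cases hjS' : j ∈ S'
    · exact support_globalCentre_subset_iUnion_of_mem hj hjS' hbj hΘ0 hΘs hπ hperm hread hperm'
    · rw [Finset.erase_eq_of_notMem hjS']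
      exact support_globalCentre_subset_iUnion hj hjS' hbj hΘ0 hΘs hπ hperm hread hperm'
  · by_cases hjS' : j ∈ S'
    · obtain ⟨Θ, τ, g, hisoΘ, h0', hτ, hτj, hτl, hτS, hτb, hrest⟩ :=
        exists_shear_chart_reading_of_mem hj hjS' hbj hF hclean hΘ0 hΘs hπ hperm hread hperm' hl hlS'
      refine ⟨Θ, τ, g, hisoΘ, h0', hτ, hτj, hτl, hτS, hτb, ?_⟩
      simp only [if_pos hjS']
      exact hrest
    · obtain ⟨Θ, τ, g, hisoΘ, h0', hτ, hτj, hτl, hτS, hτb, hrest⟩ :=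
        exists_shear_chart_reading hj hjS' hbj hF hclean hΘ0 hΘs hπ hperm hread hperm' hl hlS' hjl
      refine ⟨Θ, τ, g, hisoΘ, h0', hτ, hτj, hτl, hτS, hτb, ?_⟩
      simp only [if_neg hjS']
      exact hrest

end ChartDictionary

end Summit.ResolutionOfSingularities.ResolutionOfSingularities.Theorems.PIDim4

end
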